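import Mathlib.LinearAlgebra.DirectSum.Finsupp
import Literature.AlgebraicGeometry.Motives.HodgeTensorHomProofs
import Literature.AlgebraicGeometry.Motives.MumfordTateInvariantsHodgeBasis
import HarnessLib

/-!
# The Lie algebra of the Mumford–Tate stabiliser and the Hodge grading (Mumford–Tate invariants, step 6)

Let `H` be a pure `ℚ`-Hodge structure on a finite-dimensional `V`. The tree's Mumford–Tate group
`MT(H) = H.mumfordTateGroup ≤ GL(V)(ℚ)` is the group of rational points of the stabiliser of
all weight-`0` Hodge tensors of type `(0,0)`. Its LIE ALGEBRA over `ℚ` is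
`lieStabilizer H = 𝔰 := {X ∈ End_ℚ V | ρ(X) t = 0 for every weight-0 Hodge (0,0)-tensor t}`
(`ρ = tensorDerivation`, the infinitesimal action). The key input of Deligne's proof of
Prop. 3.4 of *Hodge cycles on abelian varieties* (I §3) — "a tensor is of type `(0,0)` iff it is
fixed by `μ(𝔾ₘ)`", so that `μ(𝔾ₘ) ⊆ MT_ℂ` — is recorded here in infinitesimal form: the
**Hodge grading operator** `Θ = dμ(1)` (`gradingEnd e deg`, acting by `p` on `V^{p,q}`, written in
a graded basis `e` of `V_ℂ`) lies in the complexified Lie algebra,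
`Θ ∈ ℂ ⊗ 𝔰 ⊆ End_ℂ(V_ℂ)` (`gradingEnd_mem_span_lieStabilizer`). Consequences:

* `exists_mem_lieStabilizer_apply_ne_zero`: a weight-`0` rational tensor killed by `𝔰` is a
  Hodge class of type `(0,0)` (Lie-algebra form of "Hodge tensors = MT-invariants",
  Deligne I 3.4 / Green–Griffiths–Kerr (I.B.1));
* `subspaceBaseChange_gradingEnd_stable`: for a rational subspace `W ⊆ T^{a,b}` stable under
  `𝔰`, its complexification is stable under `ρ(Θ)` (so `W` is a sub-Hodge structure; GGK (I.B.5)).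

Ingredients: the base change of an intersection of kernels (`mem_baseChange_iInf_ker`, via a
`ℚ`-basis of `ℂ`: `ℂ ⊗ M ≅ ⊕_I M`), the bijection `ℂ ⊗ End_ℚ V ≅ End_ℂ V_ℂ`
(`homBaseChange_bijective`) and the tensor-basis criterion of `MumfordTateInvariantsHodgeBasis`.

## References

* P. Deligne, *Hodge cycles on abelian varieties*, LNM 900 (1982), I §3, Prop. 3.4 and its proof.
* M. Green, P. Griffiths, M. Kerr, *Mumford–Tate groups and domains*, Ann. Math. Stud. 183
  (2012), I.B, (I.B.1) and (I.B.5).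
-/

noncomputable section

open scoped TensorProduct PiTensorProduct

namespace Literature.AlgebraicGeometry.Motives

universe u v w

/-! ### Base change of an intersection of kernels -/

section KerBaseChange

variable {M : Type u} [AddCommGroup M] [Module ℚ M]

/-- Coordinates of `ℂ ⊗_ℚ P` with respect to a fixed `ℚ`-basis of `ℂ`: `ℂ ⊗_ℚ P ≃ₗ[ℚ] (I →₀ P)`
(`I` the index type of `Module.Free.chooseBasis ℚ ℂ`). [folklore] -/
def ratCoord (P : Type v) [AddCommGroup P] [Module ℚ P] :
    ℂ ⊗[ℚ] P ≃ₗ[ℚ] (Module.Free.ChooseBasisIndex ℚ ℂ →₀ P) :=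
  (TensorProduct.congr (Module.Free.chooseBasis ℚ ℂ).repr (LinearEquiv.refl ℚ P)).trans
    (TensorProduct.finsuppScalarLeft ℚ P (Module.Free.ChooseBasisIndex ℚ ℂ))

/-- The coordinates of `c ⊗ p` are `i ↦ cᵢ • p` (`cᵢ` the coordinates of `c`). [folklore] -/
theorem ratCoord_tmul_apply {P : Type v} [AddCommGroup P] [Module ℚ P] (c : ℂ) (p : P)
    (i : Module.Free.ChooseBasisIndex ℚ ℂ) :
    ratCoord P (c ⊗ₜ[ℚ] p) i = (Module.Free.chooseBasis ℚ ℂ).repr c i • p := by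
  simp [ratCoord]

/-- The inverse coordinate map on a single coordinate: `single i p ↦ bᵢ ⊗ p`. [folklore] -/
theorem ratCoord_symm_single {P : Type v} [AddCommGroup P] [Module ℚ P]
    (i : Module.Free.ChooseBasisIndex ℚ ℂ) (p : P) :
    (ratCoord P).symm (Finsupp.single i p) = (Module.Free.chooseBasis ℚ ℂ i) ⊗ₜ[ℚ] p := by
  simp [ratCoord, LinearEquiv.trans_symm, TensorProduct.finsuppScalarLeft_symm_apply_single]

/-- Naturality of the coordinates: the coordinates of `f_ℂ x` are `f` applied to the coordinates
of `x`. [folklore] -/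
theorem ratCoord_baseChange {P : Type v} [AddCommGroup P] [Module ℚ P] (f : M →ₗ[ℚ] P)
    (x : ℂ ⊗[ℚ] M) (i : Module.Free.ChooseBasisIndex ℚ ℂ) :
    ratCoord P (f.baseChange ℂ x) i = f (ratCoord M x i) := by
  induction x using TensorProduct.induction_on with
  | zero => simp
  | tmul c m => rw [LinearMap.baseChange_tmul, ratCoord_tmul_apply, ratCoord_tmul_apply, map_smul]
  | add x y hx hy => rw [map_add, map_add, Finsupp.add_apply, hx, hy, map_add, Finsupp.add_apply,
      map_add]

/-- Reconstruction from coordinates: `x = Σᵢ bᵢ ⊗ xᵢ`. [folklore] -/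
theorem eq_sum_tmul_ratCoord (x : ℂ ⊗[ℚ] M) :
    x = (ratCoord M x).sum fun i m => (Module.Free.chooseBasis ℚ ℂ i) ⊗ₜ[ℚ] m := by
  conv_lhs => rw [← (ratCoord M).symm_apply_apply x, ← Finsupp.sum_single (ratCoord M x),
    map_finsuppSum]
  simp only [ratCoord_symm_single]

/-- **Base change commutes with intersections of kernels** (for an arbitrary family of
`ℚ`-linear maps): an element of `ℂ ⊗ M` killed by all `(φ α)_ℂ` lies in the complexification of
`⨅ α, ker (φ α)` (expand in a `ℚ`-basis of `ℂ`: each coordinate lies in every kernel). [folklore] -/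
theorem mem_baseChange_iInf_ker {ι : Type v} {N : ι → Type w} [∀ α, AddCommGroup (N α)]
    [∀ α, Module ℚ (N α)] (φ : ∀ α, M →ₗ[ℚ] N α) {ξ : ℂ ⊗[ℚ] M}
    (h : ∀ α, (φ α).baseChange ℂ ξ = 0) :
    ξ ∈ (⨅ α, LinearMap.ker (φ α)).baseChange ℂ := by
  have hcoord : ∀ i, ratCoord M ξ i ∈ ⨅ α, LinearMap.ker (φ α) := by
    intro i
    rw [Submodule.mem_iInf]
    intro α
    rw [LinearMap.mem_ker, ← ratCoord_baseChange, h α, map_zero, Finsupp.zero_apply]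
  rw [eq_sum_tmul_ratCoord ξ]
  exact Submodule.sum_mem _ fun i _ => Submodule.tmul_mem_baseChange_of_mem _ (hcoord i)

end KerBaseChange

/-! ### The Hodge grading operator in a graded basis -/

section Grading

variable {W : Type u} [AddCommGroup W] [Module ℂ W] {S : Type v} [Fintype S] [DecidableEq S]

/-- The **grading operator** of a graded basis: `Θ (e σ) = (deg σ) • e σ`. For a graded basis of
`V_ℂ` adapted to the Hodge decomposition (`e σ ∈ V^{deg σ, ·}`) this is `Θ = p` on `V^{p,q}`,
the differential `dμ(1)` of Deligne's cocharacter `μ` (*Hodge cycles on abelian varieties*, I §3,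
before 3.4: `μ(λ) = λ^{-p}` on `V^{p,q}`, up to the sign convention of Rem. 3.3). [folklore] -/
def gradingEnd (e : Module.Basis S ℂ W) (deg : S → ℤ) : Module.End ℂ W :=
  e.constr ℂ fun σ => (deg σ : ℂ) • e σ

/-- The grading operator is diagonal in the graded basis. [folklore] -/
theorem gradingEnd_apply_basis (e : Module.Basis S ℂ W) (deg : S → ℤ) (σ : S) :
    gradingEnd e deg (e σ) = (deg σ : ℂ) • e σ := by
  simp [gradingEnd]

/-- **The grading operator acts on the tensor basis by the total degree**:
`ρ(Θ) (E x) = (tensorDegree deg x) • E x` (infinitesimal form of "`μ(λ)` acts on a tensor of type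
`(P,Q)` by `λ^{-P}`", Deligne I, proof of 3.4). [cite: Deligne1982HodgeCycles, I proof of Prop. 3.4] -/
theorem tensorDerivation_gradingEnd_hodgeTensorBasis (e : Module.Basis S ℂ W) (deg : S → ℤ)
    {a b : ℕ} (x : (Fin a → S) × (Fin b → S)) :
    tensorDerivation a b (gradingEnd e deg) (hodgeTensorBasis e a b x) =
      (tensorDegree deg x : ℂ) • hodgeTensorBasis e a b x := by
  rw [tensorDerivation_hodgeTensorBasis' e (gradingEnd_apply_basis e deg) x, tensorDegree_apply]
  push_cast
  rfl

/-- The kernel of `ρ(Θ)` on `T^{a,b}` is the span of the tensor basis vectors of total degree `0`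
(`Θ` is diagonal with integer eigenvalues). [folklore] -/
theorem ker_tensorDerivation_gradingEnd (e : Module.Basis S ℂ W) (deg : S → ℤ) (a b : ℕ) :
    LinearMap.ker (tensorDerivation a b (gradingEnd e deg)) =
      Submodule.span ℂ (hodgeTensorBasis e a b '' {x | tensorDegree deg x = 0}) := by
  rw [ker_eq_span_of_diag (hodgeTensorBasis e a b) (tensorDerivation_gradingEnd_hodgeTensorBasis e deg)]
  simp only [Int.cast_eq_zero]

end Grading

/-! ### The Lie algebra of the stabiliser of the Hodge tensors -/

namespace HodgeStructure

variable {V : Type u} [AddCommGroup V] [Module ℚ V] [Module.Finite ℚ V] [HodgeTensorFacts.{u, u}]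
  {n : ℤ}

/-- An index for the weight-`0` Hodge tensors of type `(0,0)` of `H`: a bidegree `(a, b)` with
`(a - b) n = 0` and a Hodge class `t ∈ Hdg^{0,0}(T^{a,b})`. [folklore] -/
structure HodgeTensorIdx (H : HodgeStructure V n) where
  /-- number of covariant factors -/
  a : ℕ
  /-- number of contravariant factors -/
  b : ℕ
  /-- the weight `(a - b) n` of `T^{a,b}` vanishes -/
  hab : ((a : ℤ) - b) * n = 0
  /-- the Hodge tensor -/
  t : hodgeTensorSpace V a b
  /-- `t` is a Hodge class of type `(0,0)` -/
  ht : t ∈ (H.tensorSpace a b).hodgeClasses 0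

/-- The linear map `X ↦ ρ(X) t` whose kernel is the infinitesimal stabiliser of the tensor `t`.
[folklore] -/
def derivationAt {a b : ℕ} (t : hodgeTensorSpace V a b) :
    Module.End ℚ V →ₗ[ℚ] hodgeTensorSpace V a b :=
  (LinearMap.applyₗ t).comp (tensorDerivation a b)

omit [Module.Finite ℚ V] [HodgeTensorFacts.{u, u}] in
/-- `derivationAt t X = ρ(X) t`. [folklore] -/
@[simp]
theorem derivationAt_apply {a b : ℕ} (t : hodgeTensorSpace V a b) (X : Module.End ℚ V) :
    derivationAt t X = tensorDerivation a b X t :=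
  rfl

/-- **The Lie algebra `𝔰` of the Mumford–Tate stabiliser** (over `ℚ`): the endomorphisms `X` of
`V` whose derivation action kills every weight-`0` Hodge tensor of type `(0,0)` — the Lie algebra
of the `ℚ`-group whose rational points are `H.mumfordTateGroup` (Deligne, LNM 900, I 3.4: `MT` is
the stabiliser of the Hodge tensors; Borel, *Linear Algebraic Groups*, §3.8–3.9 for the Lie
algebra of a stabiliser). [folklore] -/
def lieStabilizer (H : HodgeStructure V n) : Submodule ℚ (Module.End ℚ V) :=
  ⨅ α : H.HodgeTensorIdx, LinearMap.ker (derivationAt α.t)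

/-- Membership in `𝔰`: `ρ(X)` kills every weight-`0` Hodge tensor of type `(0,0)`. [folklore] -/
theorem mem_lieStabilizer_iff (H : HodgeStructure V n) (X : Module.End ℚ V) :
    X ∈ H.lieStabilizer ↔ ∀ (a b : ℕ), ((a : ℤ) - b) * n = 0 →
      ∀ t ∈ (H.tensorSpace a b).hodgeClasses 0, tensorDerivation a b X t = 0 := by
  simp only [lieStabilizer, Submodule.mem_iInf, LinearMap.mem_ker, derivationAt_apply]
  exact ⟨fun h a b hab t ht => h ⟨a, b, hab, t, ht⟩, fun h α => h α.a α.b α.hab α.t α.ht⟩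

/-- **The grading operator kills the complexified Hodge tensors**: for a graded basis `e` of
`V_ℂ` adapted to `H` and a weight-`0` Hodge class `t` of type `(0,0)`, `ρ(Θ) (ι t) = 0`
(Deligne I, proof of 3.4: `μ(𝔾ₘ)` fixes the tensors of type `(0,0)`).
[cite: Deligne1982HodgeCycles, I proof of Prop. 3.4] -/
theorem tensorDerivation_gradingEnd_tensorSpaceToBaseChange_eq_zero (H : HodgeStructure V n)
    {S : Type u} [Fintype S] [DecidableEq S] {deg : S → ℤ} (e : Module.Basis S ℂ (ℂ ⊗[ℚ] V))
    (hF : ∀ p, H.F p = Submodule.span ℂ (e '' {σ | p ≤ deg σ}))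
    (hFc : ∀ p, complexConj (H.F p) = Submodule.span ℂ (e '' {σ | deg σ ≤ n - p})) {a b : ℕ}
    (hab : ((a : ℤ) - b) * n = 0) {t : hodgeTensorSpace V a b}
    (ht : t ∈ (H.tensorSpace a b).hodgeClasses 0) :
    tensorDerivation a b (gradingEnd e deg) (tensorSpaceToBaseChange ℂ V a b t) = 0 := by
  rw [← LinearMap.mem_ker, ker_tensorDerivation_gradingEnd]
  exact tensorSpaceToBaseChange_mem_span_degree_zero H e hF hFc hab ht

/-- The comparison `ℂ ⊗ End_ℚ V ≃ₗ[ℂ] End_ℂ V_ℂ` (`homBaseChange`, bijective for `V`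
finite-dimensional by `homBaseChange_bijective`). [folklore] -/
def endBaseChangeEquiv (V : Type u) [AddCommGroup V] [Module ℚ V] [Module.Finite ℚ V] :
    ℂ ⊗[ℚ] Module.End ℚ V ≃ₗ[ℂ] Module.End ℂ (ℂ ⊗[ℚ] V) :=
  LinearEquiv.ofBijective (homBaseChange V V) homBaseChange_bijective

omit [HodgeTensorFacts.{u, u}] in
/-- `endBaseChangeEquiv V (c ⊗ X) = c • X_ℂ`. [folklore] -/
theorem endBaseChangeEquiv_tmul (c : ℂ) (X : Module.End ℚ V) :
    endBaseChangeEquiv V (c ⊗ₜ[ℚ] X) = c • X.baseChange ℂ :=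
  homBaseChange_tmul c X

omit [HodgeTensorFacts.{u, u}] in
/-- Compatibility of `derivationAt` with base change: `ι ((derivationAt t)_ℂ ξ) = ρ(ξ_ℂ) (ι t)`,
where `ξ_ℂ = endBaseChangeEquiv V ξ`. [folklore] -/
theorem hodgeTensorSpaceBaseChange_derivationAt_baseChange {a b : ℕ} (t : hodgeTensorSpace V a b)
    (ξ : ℂ ⊗[ℚ] Module.End ℚ V) :
    hodgeTensorSpaceBaseChange V a b ((derivationAt t).baseChange ℂ ξ) =
      tensorDerivation a b (endBaseChangeEquiv V ξ) (tensorSpaceToBaseChange ℂ V a b t) := by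
  induction ξ using TensorProduct.induction_on with
  | zero => simp
  | tmul c X =>
    rw [LinearMap.baseChange_tmul, derivationAt_apply, hodgeTensorSpaceBaseChange_tmul,
      endBaseChangeEquiv_tmul, map_smul, LinearMap.smul_apply, ← hodgeTensorSpaceBaseChange_one_tmul,
      ← hodgeTensorSpaceBaseChange_one_tmul, ← LinearMap.baseChange_tmul,
      hodgeTensorSpaceBaseChange_tensorDerivation]
  | add x y hx hy => rw [map_add, map_add, hx, hy, map_add, map_add, LinearMap.add_apply]

/-- **The Hodge grading operator lies in the complexified Lie algebra of the stabiliser**: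
`Θ ∈ span_ℂ {X_ℂ | X ∈ 𝔰}` — the infinitesimal form of `μ(𝔾ₘ) ⊆ MT(H)_ℂ` (Deligne, LNM 900, I,
proof of Prop. 3.4: the tensors of type `(0,0)` are exactly those fixed by `μ(𝔾ₘ)`, hence
`μ(𝔾ₘ)` lies in the stabiliser of the Hodge tensors, a `ℚ`-group). Proof: `Θ = Σ cᵢ Xᵢ` in a
`ℚ`-basis `(cᵢ)` of `ℂ`; since `ρ(Θ)` kills every complexified Hodge tensor and the kernel
conditions are `ℚ`-linear, each `Xᵢ` lies in `𝔰` (`mem_baseChange_iInf_ker`).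
[cite: Deligne1982HodgeCycles, I proof of Prop. 3.4] -/
theorem gradingEnd_mem_span_lieStabilizer (H : HodgeStructure V n)
    {S : Type u} [Fintype S] [DecidableEq S] {deg : S → ℤ} (e : Module.Basis S ℂ (ℂ ⊗[ℚ] V))
    (hF : ∀ p, H.F p = Submodule.span ℂ (e '' {σ | p ≤ deg σ}))
    (hFc : ∀ p, complexConj (H.F p) = Submodule.span ℂ (e '' {σ | deg σ ≤ n - p})) :
    gradingEnd e deg ∈ Submodule.span ℂ
      ((fun X : Module.End ℚ V => X.baseChange ℂ) '' (H.lieStabilizer : Set (Module.End ℚ V))) := by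
  set ξ := (endBaseChangeEquiv V).symm (gradingEnd e deg) with hξ
  have hξmem : ξ ∈ H.lieStabilizer.baseChange ℂ := by
    refine mem_baseChange_iInf_ker (fun α : H.HodgeTensorIdx => derivationAt α.t) fun α => ?_
    apply (hodgeTensorSpaceBaseChange V α.a α.b).injective
    rw [hodgeTensorSpaceBaseChange_derivationAt_baseChange, map_zero, hξ, LinearEquiv.apply_symm_apply]
    exact tensorDerivation_gradingEnd_tensorSpaceToBaseChange_eq_zero H e hF hFc α.hab α.ht
  have hΘ : gradingEnd e deg = endBaseChangeEquiv V ξ := by rw [hξ, LinearEquiv.apply_symm_apply]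
  rw [hΘ]
  rw [Submodule.baseChange_eq_span] at hξmem
  have h := Submodule.mem_map_of_mem (f := (endBaseChangeEquiv V).toLinearMap) hξmem
  rw [Submodule.map_span, Submodule.map_coe, ← Set.image_comp] at h
  have hfun : (⇑(endBaseChangeEquiv V).toLinearMap ∘ ⇑(TensorProduct.mk ℚ ℂ (Module.End ℚ V) 1)) =
      fun X : Module.End ℚ V => X.baseChange ℂ := by
    funext X
    simp [endBaseChangeEquiv_tmul]
  rw [hfun] at h
  exact h

/-- **A weight-`0` rational tensor killed by the Lie algebra `𝔰` is a Hodge class of type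
`(0,0)`** (Lie-algebra form of "Hodge tensors = Mumford–Tate invariants", Deligne I 3.4,
GGK (I.B.1)): contrapositively, if `t ∉ Hdg^{0,0}` some `X ∈ 𝔰` has `ρ(X) t ≠ 0`. Proof: every
element of `span_ℂ {X_ℂ | X ∈ 𝔰} ∋ Θ` kills `ι t`, and `ker ρ(Θ)` is the degree-`0` span.
[cite: Deligne1982HodgeCycles, I Prop. 3.4] -/
theorem exists_mem_lieStabilizer_apply_ne_zero (H : HodgeStructure V n) {a b : ℕ}
    {t : hodgeTensorSpace V a b} (ht : t ∉ (H.tensorSpace a b).hodgeClasses 0) :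
    ∃ X ∈ H.lieStabilizer, tensorDerivation a b X t ≠ 0 := by
  by_contra hcon
  simp only [not_exists, not_and, not_not] at hcon
  obtain ⟨S, deg, e, hF, hFc⟩ := exists_basis_F_eq_span H
  haveI : Fintype S := FiniteDimensional.fintypeBasisIndex e
  classical
  apply ht
  refine mem_hodgeClasses_of_mem_span_degree_zero H e hF ?_
  rw [← ker_tensorDerivation_gradingEnd e deg a b, LinearMap.mem_ker]
  have key : ∀ Y ∈ Submodule.span ℂ
      ((fun X : Module.End ℚ V => X.baseChange ℂ) '' (H.lieStabilizer : Set (Module.End ℚ V))),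
      tensorDerivation a b Y (tensorSpaceToBaseChange ℂ V a b t) = 0 := by
    intro Y hY
    induction hY using Submodule.span_induction with
    | mem Y hY =>
      obtain ⟨X, hX, rfl⟩ := hY
      rw [← hodgeTensorSpaceBaseChange_one_tmul, ← hodgeTensorSpaceBaseChange_tensorDerivation,
        LinearMap.baseChange_tmul, hcon X hX, TensorProduct.tmul_zero, map_zero]
    | zero => simp
    | add x y _ _ hx hy => rw [map_add, LinearMap.add_apply, hx, hy, add_zero]
    | smul c x _ hx => rw [map_smul, LinearMap.smul_apply, hx, smul_zero]
  exact key _ (gradingEnd_mem_span_lieStabilizer H e hF hFc)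

/-- **The complexification of an `𝔰`-stable rational subspace of `T^{a,b}` is stable under the
grading operator `ρ(Θ)`** (so it is a sub-Hodge structure: GGK (I.B.5), "a subspace is a sub-Hodge
structure iff it is `M`-stable", infinitesimal form). [cite: GreenGriffithsKerr2012, I.B.5] -/
theorem subspaceBaseChange_gradingEnd_stable (H : HodgeStructure V n)
    {S : Type u} [Fintype S] [DecidableEq S] {deg : S → ℤ} (e : Module.Basis S ℂ (ℂ ⊗[ℚ] V))
    (hF : ∀ p, H.F p = Submodule.span ℂ (e '' {σ | p ≤ deg σ}))
    (hFc : ∀ p, complexConj (H.F p) = Submodule.span ℂ (e '' {σ | deg σ ≤ n - p})) {a b : ℕ}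
    (W : Submodule ℚ (hodgeTensorSpace V a b))
    (hW : ∀ X ∈ H.lieStabilizer, ∀ w ∈ W, tensorDerivation a b X w ∈ W)
    {s : hodgeTensorSpaceOver ℂ (ℂ ⊗[ℚ] V) a b} (hs : s ∈ subspaceBaseChange V W) :
    tensorDerivation a b (gradingEnd e deg) s ∈ subspaceBaseChange V W := by
  have key : ∀ Y ∈ Submodule.span ℂ
      ((fun X : Module.End ℚ V => X.baseChange ℂ) '' (H.lieStabilizer : Set (Module.End ℚ V))),
      tensorDerivation a b Y s ∈ subspaceBaseChange V W := by
    intro Y hY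
    induction hY using Submodule.span_induction with
    | mem Y hY =>
      obtain ⟨X, hX, rfl⟩ := hY
      exact tensorDerivation_mem_subspaceBaseChange V W (hW X hX) hs
    | zero => simp
    | add x y _ _ hx hy =>
      rw [map_add, LinearMap.add_apply]
      exact Submodule.add_mem _ hx hy
    | smul c x _ hx =>
      rw [map_smul, LinearMap.smul_apply]
      exact Submodule.smul_mem _ c hx
  exact key _ (gradingEnd_mem_span_lieStabilizer H e hF hFc)

end HodgeStructure

end Literature.AlgebraicGeometry.Motives

end
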